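import Summits.Ventures.YMGap.Conjectures.StrongCouplingSUNSchwingerDysonBetaSetup
import HarnessLib
import HarnessLib.Audit.Tags

/-!
# The Schwinger–Dyson side for `SU(N)` at `β ≥ 0` (2/3): one link over `SU(N)` with the plaquette weight —
# the exact split of the main term into the mesonic part and the BARYON HOP

Cell `pub-ymgap`, seat qcd-lit g27 (literature-prover), `bears_on: Q1`.  Everything is a theorem (0 facts,
0 sorry).  Sequel of `…SUNSchwingerDysonBetaSetup`; the `SU(N)` twin of `…ChiralLROSchwingerDysonOneLink/Sharp`
(qcd-lit g19, `G = U(N)`), now keeping the BARYON HOP of the Rossi–Wolff `SU(N)` one-link integral exact.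

For `x` even, a bond `e ∋ x`, `F` in the chiral cone, `β ≥ 0`, write one bond term of the Schwinger–Dyson
equation with the variable of `e` resampled over `SU(N)` (`suKinJ_eq_integral_prod`) and split
`e^{-βS_W(V[e←g])} = e^{-βS_W(V[e←1])} + (e^{-βS_W(V[e←g])} - e^{-βS_W(V[e←1])})`:

* `integral_berezin_kinAt_fWSU_update` — the `SU(N)` Haar integral over the link variable turns the kinetic
  insertion into the insertion polynomial `N_x F^{SU}_e` of the `SU(N)` bond factor (Literature
  `integral_berezin_kinAt_update_SU`), which is (`chargeOp_bar_bondFactorSU_eq`) the `U(N)` mesonic polynomial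
  `∑_k k a_k (σσ)_e^k` PLUS `N · B_{x,e}`, `B_{x,e} = c_e b̄(x) b(z_e)` the BARYON HOP across `e` from `x`
  (`baryonHop`; `|c_e| = 2^{-N}`);
* **`re_mainTerm_SU_eq`** (exact): `Re(s·main_e(F)) = M_e(F) + N · Q_e^β(F)` with the mesonic part
  `M_e(F) = ∫ e^{-βS_W(V[e←1])} Re(s∫dψ̄dψ F (∑_k k a_k (σσ)_e^k) e^{A_{∖e}(V)}) ∏dV` and the **baryon link density**
  `Q_e^β(F) = ∫ e^{-βS_W(V[e←1])} Re(s∫dψ̄dψ F · B_{x,e} · e^{A_{∖e}(V)}) ∏dV` (`baryonLinkSU`);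
* **`re_mesonMain_SU_le`**: `M_e(F) ≤ N² e^{βc} S_β(F(σσ)_e)` (Salmhofer–Seiler's `n a_n ≤ N² a_{n-1}` at fixed
  gauge field, Literature `re_mesonInsertion_le_sharp`; a meson insertion kills the baryon hops,
  `spinPair_mul_bondFactorSU`; then the plaquette comparison `e^{-βS_W(V[e←1])} ≤ e^{βc} e^{-βS_W(V[e←g])}`);
* the remainder and the assembled bond bound `Re(s I_e(F)) ≤ N² e^{βc} S_β(F(σσ)_e) + N Q_e^β(F) + κ(β)(…)` are
  in the sequel `…SUNSchwingerDysonBetaSite`.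

For `G = U(N)` the term `Q_e^β` is absent; it is the only place where the baryon loops of Salmhofer–Seiler §5
p. 424 enter the Schwinger–Dyson side at `β ≥ 0`.  At `β = 0` and `F = 1`, `∑_{e∋x} Q_e^0(1)/Z` is the signed
weight of the baryon loops of length `≥ 4` through `x` of the monomer–dimer–polymer representation (the link
`e` has been integrated out, so the loop returns to `x` through other links), the quantity that the tree's
`β = 0` theorem `sum_nbr_fermiExpectSU_ge_torus` controls by loop surgery.

Honest framing: finite even torus, one staggered flavour; identities and bounds at fixed `β ≥ 0`, every `L`;
nothing about the thermodynamic/continuum limit or the summit's QCD conjunct; no bound on `Q_e^β` is claimed.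

## References
* [SalmhoferSeiler1991] M. Salmhofer, E. Seiler, Commun. Math. Phys. 139 (1991) 395–432, §2 (2.3), (2.12),
  (2.16)–(2.23), (3.44)–(3.46), (4.31)–(4.34), §5 p. 424.
* [SeilerLNP1982] E. Seiler, LNP 159 (1982), Ch. 2.
* [MontvayMunster1994] I. Montvay, G. Münster, *Quantum Fields on a Lattice* (1994) §5.1.4 (5.42)–(5.44),
  §5.1.6 (5.120)–(5.121).
* [RossiWolff1984] P. Rossi, U. Wolff, Nucl. Phys. B248 (1984) 105–129, (13)–(23).
-/

noncomputable section

open MeasureTheory Finset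
open scoped ComplexConjugate Matrix BigOperators
open Literature.MathematicalPhysics.QuantumFieldTheory (Site Edge GaugeConfig wilsonAction haarProbability)
open Literature.MathematicalPhysics.QuantumLattice
open Literature.MathematicalPhysics.QuantumLattice.GrassmannAlgebra
open Literature.MathematicalPhysics.QuantumLattice.StrongCoupling
open Literature.MathematicalPhysics.QuantumLattice.StaggeredDeterminant (eoParity)
open Literature.MathematicalPhysics.StatisticalMechanics (ComplexSpin.uNBondCoeff)
open Literature.Probability.LatticeModels (TorusSite)

namespace Summit.Ventures.YMGap.Conjectures

namespace SchwingerDysonSU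

open SchwingerDyson MesonWeightSU

variable {N ν L : ℕ} [NeZero ν] [NeZero L] [LinearOrder (TorusSite ν L)]

/-! ### One link over `SU(N)` at an `SU(N)` gauge field -/

omit [NeZero ν] [NeZero L] [LinearOrder (TorusSite ν L)] in
/-- Updating the `SU(N)` field and including it into `U(N)` commute. [cite: SalmhoferSeiler1991, §2 (2.12)] -/
theorem inclSU_comp_update (V : GaugeConfig ν L (OneLink.SUN N)) (e : Edge ν L) (g : OneLink.SUN N) :
    (fun b => OneLink.inclSU N (Function.update V e g b) : GaugeConfig ν L (OneLink.UN N)) =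
      Function.update (fun b => OneLink.inclSU N (V b)) e (OneLink.inclSU N g) := by
  funext b
  by_cases hb : b = e
  · subst hb; simp only [Function.update_self]
  · simp only [Function.update_of_ne hb]

/-- The kinetic insertion at the updated `SU(N)` field. [cite: SalmhoferSeiler1991, (3.45)–(3.46)] -/
theorem kinAt_inclSU_update (x : TorusSite ν L) (V : GaugeConfig ν L (OneLink.SUN N)) (e : Edge ν L) (g : OneLink.SUN N) :
    kinAt x (torusLinks ν L) (apSigns ν L) (fun b => OneLink.inclSU N (Function.update V e g b)) e =
      kinAt x (torusLinks ν L) (apSigns ν L) (Function.update (fun b => OneLink.inclSU N (V b)) e (OneLink.inclSU N g)) e := by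
  rw [inclSU_comp_update]

/-- `e^{A(V[e←g])}` at the updated `SU(N)` field. [cite: SalmhoferSeiler1991, §2 (2.3)] -/
theorem fWSU_update (V : GaugeConfig ν L (OneLink.SUN N)) (e : Edge ν L) (g : OneLink.SUN N) :
    fWSU (N := N) (Function.update V e g) = grassmannExp (actionOn Finset.univ (torusLinks ν L) (apSigns ν L)
      (Function.update (fun b => OneLink.inclSU N (V b)) e (OneLink.inclSU N g))) := by
  rw [← inclSU_comp_update]

/-- **The `SU(N)` Haar integral of the link factor at an `SU(N)` gauge field**:
`∫_{SU(N)} dg ∫dψ̄dψ G e^{A(V[e←g])} = ∫dψ̄dψ G · F^{SU}_e · e^{A_{∖e}(V)}` with the Rossi–Wolff `SU(N)` bond factor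
(mesons AND baryon hops). [cite: RossiWolff1984, (13)–(23)] [cite: SalmhoferSeiler1991, §2 (2.16)–(2.19)] -/
theorem integral_berezin_fWSU_update (hL : Even L) (hN : 0 < N) (e : Edge ν L) (G : FermiAlg (TorusSite ν L) N)
    (V : GaugeConfig ν L (OneLink.SUN N)) :
    ∫ g, berezin ℂ _ (G * fWSU (Function.update V e g)) ∂(haarProbability (OneLink.SUN N)) =
      berezin ℂ _ (G * bondFactorSU (torusLinks ν L e).1 (torusLinks ν L e).2 (apSigns ν L e) *
        grassmannExp (actionOn (Finset.univ.erase e) (torusLinks ν L) (apSigns ν L) (fun b => OneLink.inclSU N (V b)))) := by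
  simp_rw [fWSU_update]
  exact integral_berezin_update_SU (Finset.mem_univ e) (torusLinks ν L)
    (torusLinks_ne (StaggeredRP.one_lt_of_even_neZero hL) e) (apSigns_sq e) hN _ G

/-- **The `SU(N)` Haar integral of the kinetic insertion at an `SU(N)` gauge field**:
`∫_{SU(N)} dg ∫dψ̄dψ F kin_{x,e}(V[e←g]) e^{A(V[e←g])} = ∫dψ̄dψ F · N_x F^{SU}_e · e^{A_{∖e}(V)}`. [cite: SalmhoferSeiler1991, (3.44)–(3.46)] [cite: RossiWolff1984, (13)–(23)] -/
theorem integral_berezin_kinAt_fWSU_update (hL : Even L) (hN : 0 < N) (x : TorusSite ν L) (e : Edge ν L)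
    (F : FermiAlg (TorusSite ν L) N) (V : GaugeConfig ν L (OneLink.SUN N)) :
    ∫ g, berezin ℂ _ (F * kinAt x (torusLinks ν L) (apSigns ν L) (fun b => OneLink.inclSU N (Function.update V e g b)) e *
        fWSU (Function.update V e g)) ∂(haarProbability (OneLink.SUN N)) =
      berezin ℂ _ (F * chargeOp ℂ (barCharge (N := N) x)
          (bondFactorSU (torusLinks ν L e).1 (torusLinks ν L e).2 (apSigns ν L e)) *
        grassmannExp (actionOn (Finset.univ.erase e) (torusLinks ν L) (apSigns ν L) (fun b => OneLink.inclSU N (V b)))) := by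
  simp_rw [fWSU_update, kinAt_inclSU_update]
  exact integral_berezin_kinAt_update_SU x (Finset.mem_univ e) (torusLinks ν L)
    (torusLinks_ne (StaggeredRP.one_lt_of_even_neZero hL) e) (apSigns_sq e) hN _ F

/-! ### The weight with one link deleted depends continuously on the `SU(N)` gauge field -/

/-- `V ↦ e^{A_t(V)}` is coefficientwise continuous, any set `t` of links (a polynomial in the link matrices:
`A_t` has no constant part, so `e^{A_t} = ∑_{k ≤ |gen|} A_t^k/k!`). [cite: SalmhoferSeiler1991, §2 (2.3), (2.12)] -/
theorem coeffContinuous_expActionOn_SU (t : Finset (Edge ν L)) :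
    CoeffContinuous fun V : GaugeConfig ν L (OneLink.SUN N) =>
      grassmannExp (actionOn t (torusLinks ν L) (apSigns ν L) (fun b => OneLink.inclSU N (V b))) := by
  have hU : ∀ b : Edge ν L, Continuous fun V : GaugeConfig ν L (OneLink.SUN N) =>
      ((OneLink.inclSU N (V b) : OneLink.UN N) : Matrix (Fin N) (Fin N) ℂ) := fun b =>
    continuous_subtype_val.comp ((continuous_inclSU' (N := N)).comp (continuous_apply b))
  have hA : CoeffContinuous fun V : GaugeConfig ν L (OneLink.SUN N) =>
      actionOn t (torusLinks ν L) (apSigns ν L) (fun b => OneLink.inclSU N (V b)) := by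
    unfold actionOn bondTerm
    exact CoeffContinuous.sum t fun b _ => ((coeffContinuous_hopAt _ _ (hU b)).smul continuous_const).add
      ((coeffContinuous_hopAt _ _ (hU b).matrix_conjTranspose).smul continuous_const)
  refine hA.exp fun V => pow_card_succ_eq_zero_of_constPart_eq_zero ℂ ?_
  rw [actionOn, map_sum]
  exact Finset.sum_eq_zero fun b _ => by
    rw [bondTerm, map_add, map_smul, map_smul, constPart_hopAt, constPart_hopAt, smul_zero, smul_zero, add_zero]

/-- `V ↦ ∫dψ̄dψ G e^{A_{∖e}(V)}` is continuous. [cite: SalmhoferSeiler1991, §2 (2.12)] -/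
theorem continuous_berezin_erase_SU (e : Edge ν L) (G : FermiAlg (TorusSite ν L) N) :
    Continuous fun V : GaugeConfig ν L (OneLink.SUN N) => berezin ℂ _ (G *
      grassmannExp (actionOn (Finset.univ.erase e) (torusLinks ν L) (apSigns ν L) (fun b => OneLink.inclSU N (V b)))) :=
  continuous_apply_of_coeffContinuous ((CoeffContinuous.const G).mul (coeffContinuous_expActionOn_SU _)) _

/-! ### The baryon hop across a bond and the insertion polynomial of the `SU(N)` bond factor -/

variable (N ν L) in
/-- **The baryon hop across the bond `e` from its end `x`**: `B_{x,e} = c_e · b̄(x) b(z_e)`, `z_e` the other end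
of `e`, `c_e = (-1)^{N(N-1)/2} (∓Γ_e/2)^N` (upper sign when `x` is the tail of `e`) — the coefficient of `N` in the
top (baryonic) term of the insertion polynomial `N_x F^{SU}_e` of the Rossi–Wolff `SU(N)` bond factor.
[cite: RossiWolff1984, (21)–(23)] [cite: MontvayMunster1994, §5.1.4 (5.42)] -/
def baryonHop (x : TorusSite ν L) (e : Edge ν L) : FermiAlg (TorusSite ν L) N :=
  if (torusLinks ν L e).1 = x then
    ((-1 : ℂ) ^ (N * (N - 1) / 2) * (-(apSigns ν L e / 2)) ^ N) • (bbar x * bar (torusLinks ν L e).2)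
  else ((-1 : ℂ) ^ (N * (N - 1) / 2) * (apSigns ν L e / 2) ^ N) • (bbar x * bar (torusLinks ν L e).1)

/-- **The insertion polynomial of the `SU(N)` bond factor at an end `x` of `e`**:
`N_x F^{SU}_e = ∑_k k a_k (σσ)_e^k + N · B_{x,e}`. [cite: SalmhoferSeiler1991, (3.44)–(3.45)] [cite: RossiWolff1984, (21)–(23)] -/
theorem chargeOp_bar_bondFactorSU_eq (hL : Even L) (hN : N ≠ 0) {x : TorusSite ν L} {e : Edge ν L}
    (hxe : (torusLinks ν L e).1 = x ∨ (torusLinks ν L e).2 = x) :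
    chargeOp ℂ (barCharge (N := N) x) (bondFactorSU (torusLinks ν L e).1 (torusLinks ν L e).2 (apSigns ν L e) :
        FermiAlg (TorusSite ν L) N) =
      ∑ k ∈ Finset.range (N + 1), ((k : ℂ) * ComplexSpin.uNBondCoeff N k) •
          spinPair (torusLinks ν L e).1 (torusLinks ν L e).2 ^ k + (N : ℂ) • baryonHop N ν L x e := by
  have hle : (torusLinks ν L e).1 ≠ (torusLinks ν L e).2 := torusLinks_ne (StaggeredRP.one_lt_of_even_neZero hL) e
  rcases hxe with h1 | h2
  · rw [baryonHop, if_pos h1, smul_smul]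
    subst h1
    exact chargeOp_bar_bondFactorSU_fst hN hle _
  · have h1 : (torusLinks ν L e).1 ≠ x := fun h => hle (h.trans h2.symm)
    rw [baryonHop, if_neg h1, smul_smul]
    subst h2
    exact chargeOp_bar_bondFactorSU_snd hN hle _

/-! ### The baryon link density and the exact split of the main term -/

variable (N ν L) in
/-- **The baryon link density across `e` at `x`, coupling `β`, test element `F`** (frozen plaquette on `e`):
`Q_e^β(F) = ∫ e^{-βS_W(V[e←1])} · Re(s ∫dψ̄dψ F · B_{x,e} · e^{A_{∖e}(V)}) ∏dV`.  At `β = 0`, `F = 1` it is the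
signed weight of the baryon loops of length `≥ 4` through the bond `e`, seen from `x`. [cite: RossiWolff1984, (21)–(23)] [cite: SalmhoferSeiler1991, §5 p. 424] -/
def baryonLinkSU (β : ℝ) (x : TorusSite ν L) (e : Edge ν L) (F : FermiAlg (TorusSite ν L) N) : ℝ :=
  ∫ V, plaqSU N ν L β (Function.update V e 1) * (chiralSign (N := N) (evens ν L) *
    berezin ℂ _ (F * baryonHop N ν L x e *
      grassmannExp (actionOn (Finset.univ.erase e) (torusLinks ν L) (apSigns ν L) (fun b => OneLink.inclSU N (V b))))).re
    ∂(gaugeMeasureSU N (Edge ν L))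

/-- `Re(s ∫ e^{-βS}·f) = ∫ e^{-βS} Re(s f)` for an integrable `e^{-βS} f`. [cite: MontvayMunster1994, §5.1.6 (5.120)–(5.121)] -/
theorem re_mul_integral_ofReal_mul {α : Type*} [MeasurableSpace α] {μ : Measure α} (s : ℂ) {p : α → ℝ} {f : α → ℂ}
    (hf : Integrable (fun a => (p a : ℂ) * f a) μ) :
    (s * ∫ a, (p a : ℂ) * f a ∂μ).re = ∫ a, p a * (s * f a).re ∂μ := by
  rw [← integral_const_mul, ← RCLike.re_eq_complex_re, ← integral_re (hf.const_mul s)]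
  refine integral_congr_ae (ae_of_all _ fun a => ?_)
  dsimp only
  rw [RCLike.re_eq_complex_re, mul_left_comm, Complex.re_ofReal_mul]

/-- **The main term, exactly**: with the plaquette weight frozen at `V[e←1]`, the `SU(N)` Haar integral over the
link variable gives `Re(s·main_e(F)) = M_e(F) + N · Q_e^β(F)`, `M_e` the mesonic part. [cite: SalmhoferSeiler1991, (3.44)–(3.46), (4.31)] [cite: RossiWolff1984, (21)–(23)] -/
theorem re_mainTerm_SU_eq (hL : Even L) (hN : 0 < N) (β : ℝ) {x : TorusSite ν L} {e : Edge ν L}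
    (hxe : (torusLinks ν L e).1 = x ∨ (torusLinks ν L e).2 = x) (F : FermiAlg (TorusSite ν L) N) :
    (chiralSign (N := N) (evens ν L) * ∫ p, (plaqSU N ν L β (Function.update p.1 e 1) : ℂ) *
        berezin ℂ _ (F * kinAt x (torusLinks ν L) (apSigns ν L) (fun b => OneLink.inclSU N (Function.update p.1 e p.2 b)) e *
          fWSU (Function.update p.1 e p.2)) ∂((gaugeMeasureSU N (Edge ν L)).prod (haarProbability (OneLink.SUN N)))).re =
      (∫ V, plaqSU N ν L β (Function.update V e 1) * (chiralSign (N := N) (evens ν L) * berezin ℂ _ (F *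
          (∑ k ∈ Finset.range (N + 1), ((k : ℂ) * ComplexSpin.uNBondCoeff N k) •
            spinPair (torusLinks ν L e).1 (torusLinks ν L e).2 ^ k) *
          grassmannExp (actionOn (Finset.univ.erase e) (torusLinks ν L) (apSigns ν L) (fun b => OneLink.inclSU N (V b))))).re
        ∂(gaugeMeasureSU N (Edge ν L))) +
      (N : ℝ) * baryonLinkSU N ν L β x e F := by
  haveI : IsProbabilityMeasure (gaugeMeasureSU N (Edge ν L)) := by unfold gaugeMeasureSU; infer_instance
  have hA : Integrable (fun p : GaugeConfig ν L (OneLink.SUN N) × OneLink.SUN N =>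
      (plaqSU N ν L β (Function.update p.1 e 1) : ℂ) *
        berezin ℂ _ (F * kinAt x (torusLinks ν L) (apSigns ν L) (fun b => OneLink.inclSU N (Function.update p.1 e p.2 b)) e *
          fWSU (Function.update p.1 e p.2))) ((gaugeMeasureSU N (Edge ν L)).prod (haarProbability (OneLink.SUN N))) :=
    integrable_of_continuous_prod_SU ((Complex.continuous_ofReal.comp (continuous_plaqSU_upd_one β e)).mul
      (continuous_berezin_kin_upd_SU hL x e F))
  have hp1 : Continuous fun V : GaugeConfig ν L (OneLink.SUN N) => (plaqSU N ν L β (Function.update V e 1) : ℂ) :=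
    Complex.continuous_ofReal.comp ((continuous_plaqSU β).comp (continuous_id.update e continuous_const))
  have hi1 : Integrable (fun V : GaugeConfig ν L (OneLink.SUN N) => (plaqSU N ν L β (Function.update V e 1) : ℂ) *
      berezin ℂ _ (F * (∑ k ∈ Finset.range (N + 1), ((k : ℂ) * ComplexSpin.uNBondCoeff N k) •
          spinPair (torusLinks ν L e).1 (torusLinks ν L e).2 ^ k) *
        grassmannExp (actionOn (Finset.univ.erase e) (torusLinks ν L) (apSigns ν L) (fun b => OneLink.inclSU N (V b)))))
      (gaugeMeasureSU N (Edge ν L)) :=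
    integrable_of_continuous_SU (hp1.mul (continuous_berezin_erase_SU e _))
  have hi2 : Integrable (fun V : GaugeConfig ν L (OneLink.SUN N) => (plaqSU N ν L β (Function.update V e 1) : ℂ) *
      berezin ℂ _ (F * baryonHop N ν L x e *
        grassmannExp (actionOn (Finset.univ.erase e) (torusLinks ν L) (apSigns ν L) (fun b => OneLink.inclSU N (V b)))))
      (gaugeMeasureSU N (Edge ν L)) :=
    integrable_of_continuous_SU (hp1.mul (continuous_berezin_erase_SU e _))
  -- the inner `g`-integral at every `V`
  have hinner : ∀ V : GaugeConfig ν L (OneLink.SUN N),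
      ∫ g, (plaqSU N ν L β (Function.update V e 1) : ℂ) *
          berezin ℂ _ (F * kinAt x (torusLinks ν L) (apSigns ν L) (fun b => OneLink.inclSU N (Function.update V e g b)) e *
            fWSU (Function.update V e g)) ∂(haarProbability (OneLink.SUN N)) =
        (plaqSU N ν L β (Function.update V e 1) : ℂ) *
            berezin ℂ _ (F * (∑ k ∈ Finset.range (N + 1), ((k : ℂ) * ComplexSpin.uNBondCoeff N k) •
                spinPair (torusLinks ν L e).1 (torusLinks ν L e).2 ^ k) *
              grassmannExp (actionOn (Finset.univ.erase e) (torusLinks ν L) (apSigns ν L) (fun b => OneLink.inclSU N (V b)))) +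
          (N : ℂ) * ((plaqSU N ν L β (Function.update V e 1) : ℂ) *
            berezin ℂ _ (F * baryonHop N ν L x e *
              grassmannExp (actionOn (Finset.univ.erase e) (torusLinks ν L) (apSigns ν L) (fun b => OneLink.inclSU N (V b))))) := by
    intro V
    rw [integral_const_mul, integral_berezin_kinAt_fWSU_update hL hN x e F V, chargeOp_bar_bondFactorSU_eq hL hN.ne' hxe]
    simp only [mul_add, add_mul, map_add, mul_smul_comm, smul_mul_assoc, map_smul, smul_eq_mul]
    ring
  rw [integral_prod _ hA, integral_congr_ae (ae_of_all _ hinner), integral_add hi1 (hi2.const_mul _), integral_const_mul,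
    mul_add, Complex.add_re, re_mul_integral_ofReal_mul _ hi1, mul_left_comm, ← Complex.ofReal_natCast, Complex.re_ofReal_mul,
    re_mul_integral_ofReal_mul _ hi2, baryonLinkSU]

/-! ### The mesonic part of the main term: the sharp comparison and the plaquette comparison -/

/-- **The mesonic part of the main term is at most `N² e^{βc} S_β(F(σσ)_e)`** (`x` even, `e ∋ x`, `F` in the
cone, `β ≥ 0`): at every `SU(N)` gauge field `Re(s∫ F(∑_k k a_k(σσ)_e^k) e^{A_{∖e}}) ≤ N² Re(s∫ F(σσ)_e B̃_e e^{A_{∖e}})`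
(`n a_n ≤ N² a_{n-1}`), a meson insertion on `e` kills the baryon hops (`(σσ)_e F^{SU}_e = (σσ)_e B̃_e`), so the
right side is `N² Re(s ∫dg ∫ F(σσ)_e e^{A(V[e←g])})`, and `e^{-βS_W(V[e←1])} ≤ e^{βc} e^{-βS_W(V[e←g])}`. [cite: SalmhoferSeiler1991, (3.44)–(3.46) with (2.16)–(2.23), (4.31)] [cite: SeilerLNP1982, Ch. 2] -/
theorem re_mesonMain_SU_le (hL : Even L) (hN : 0 < N) {β : ℝ} (hβ : 0 ≤ β) (e : Edge ν L)
    {F : FermiAlg (TorusSite ν L) N} (hF : IsChiralPositive (evens ν L) F) :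
    (∫ V, plaqSU N ν L β (Function.update V e 1) * (chiralSign (N := N) (evens ν L) * berezin ℂ _ (F *
        (∑ k ∈ Finset.range (N + 1), ((k : ℂ) * ComplexSpin.uNBondCoeff N k) •
          spinPair (torusLinks ν L e).1 (torusLinks ν L e).2 ^ k) *
        grassmannExp (actionOn (Finset.univ.erase e) (torusLinks ν L) (apSigns ν L) (fun b => OneLink.inclSU N (V b))))).re
        ∂(gaugeMeasureSU N (Edge ν L))) ≤
      (N : ℝ) ^ 2 * Real.exp (β * linkOsc ν N) *
        suSB N ν L β (F * spinPair (torusLinks ν L e).1 (torusLinks ν L e).2) := by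
  haveI : IsProbabilityMeasure (gaugeMeasureSU N (Edge ν L)) := by unfold gaugeMeasureSU; infer_instance
  have hFT : IsChiralPositive (evens ν L) (F * spinPair (torusLinks ν L e).1 (torusLinks ν L e).2) := by
    have h := hF.mul (isChiralPositive_spinPair_pow' (N := N) (evens ν L) (torusLinks ν L e).1 (torusLinks ν L e).2 1)
    rwa [pow_one] at h
  -- the product-space integrands
  have hBc : Integrable (fun p : GaugeConfig ν L (OneLink.SUN N) × OneLink.SUN N =>
      berezin ℂ _ (F * spinPair (torusLinks ν L e).1 (torusLinks ν L e).2 * fWSU (Function.update p.1 e p.2)))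
      ((gaugeMeasureSU N (Edge ν L)).prod (haarProbability (OneLink.SUN N))) :=
    integrable_of_continuous_prod_SU (continuous_berezin_upd_SU hL e _)
  have hrc : Continuous fun p : GaugeConfig ν L (OneLink.SUN N) × OneLink.SUN N =>
      (chiralSign (N := N) (evens ν L) *
        berezin ℂ _ (F * spinPair (torusLinks ν L e).1 (torusLinks ν L e).2 * fWSU (Function.update p.1 e p.2))).re :=
    Complex.continuous_re.comp (continuous_const.mul (continuous_berezin_upd_SU hL e _))
  have hR1 : Integrable (fun p : GaugeConfig ν L (OneLink.SUN N) × OneLink.SUN N =>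
      plaqSU N ν L β (Function.update p.1 e 1) * (chiralSign (N := N) (evens ν L) *
        berezin ℂ _ (F * spinPair (torusLinks ν L e).1 (torusLinks ν L e).2 * fWSU (Function.update p.1 e p.2))).re)
      ((gaugeMeasureSU N (Edge ν L)).prod (haarProbability (OneLink.SUN N))) :=
    integrable_of_continuous_prod_SU ((continuous_plaqSU_upd_one β e).mul hrc)
  have hRg : Integrable (fun p : GaugeConfig ν L (OneLink.SUN N) × OneLink.SUN N =>
      plaqSU N ν L β (Function.update p.1 e p.2) * (chiralSign (N := N) (evens ν L) *
        berezin ℂ _ (F * spinPair (torusLinks ν L e).1 (torusLinks ν L e).2 * fWSU (Function.update p.1 e p.2))).re)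
      ((gaugeMeasureSU N (Edge ν L)).prod (haarProbability (OneLink.SUN N))) :=
    integrable_of_continuous_prod_SU ((continuous_plaqSU_upd β e).mul hrc)
  have hp1 : Continuous fun V : GaugeConfig ν L (OneLink.SUN N) => plaqSU N ν L β (Function.update V e 1) :=
    (continuous_plaqSU β).comp (continuous_id.update e continuous_const)
  have hL1 : Integrable (fun V : GaugeConfig ν L (OneLink.SUN N) => plaqSU N ν L β (Function.update V e 1) *
      (chiralSign (N := N) (evens ν L) * berezin ℂ _ (F *
        (∑ k ∈ Finset.range (N + 1), ((k : ℂ) * ComplexSpin.uNBondCoeff N k) •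
          spinPair (torusLinks ν L e).1 (torusLinks ν L e).2 ^ k) *
        grassmannExp (actionOn (Finset.univ.erase e) (torusLinks ν L) (apSigns ν L) (fun b => OneLink.inclSU N (V b))))).re)
      (gaugeMeasureSU N (Edge ν L)) :=
    integrable_of_continuous_SU (hp1.mul (Complex.continuous_re.comp (continuous_const.mul (continuous_berezin_erase_SU e _))))
  -- Step 1: pointwise in `V`, the sharp comparison and the one-link integral backwards
  have hstep1 : ∀ᵐ V ∂(gaugeMeasureSU N (Edge ν L)), plaqSU N ν L β (Function.update V e 1) *
      (chiralSign (N := N) (evens ν L) * berezin ℂ _ (F *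
        (∑ k ∈ Finset.range (N + 1), ((k : ℂ) * ComplexSpin.uNBondCoeff N k) •
          spinPair (torusLinks ν L e).1 (torusLinks ν L e).2 ^ k) *
        grassmannExp (actionOn (Finset.univ.erase e) (torusLinks ν L) (apSigns ν L) (fun b => OneLink.inclSU N (V b))))).re ≤
      (N : ℝ) ^ 2 * ∫ g, plaqSU N ν L β (Function.update V e 1) * (chiralSign (N := N) (evens ν L) *
        berezin ℂ _ (F * spinPair (torusLinks ν L e).1 (torusLinks ν L e).2 * fWSU (Function.update V e g))).re
        ∂(haarProbability (OneLink.SUN N)) := by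
    filter_upwards [hBc.prod_right_ae] with V hV
    have hkey := re_mesonInsertion_le_sharp (Finset.univ.erase e) (torusLinks ν L) (fst_mem_evens_iff hL) conj_apSigns
      (fun b => OneLink.inclSU N (V b)) hN hF (torusLinks ν L e).1 (torusLinks ν L e).2
    have hback : berezin ℂ _ (F * spinPair (torusLinks ν L e).1 (torusLinks ν L e).2 *
          bondFactor (torusLinks ν L e).1 (torusLinks ν L e).2 *
        grassmannExp (actionOn (Finset.univ.erase e) (torusLinks ν L) (apSigns ν L) (fun b => OneLink.inclSU N (V b)))) =
        ∫ g, berezin ℂ _ (F * spinPair (torusLinks ν L e).1 (torusLinks ν L e).2 * fWSU (Function.update V e g))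
          ∂(haarProbability (OneLink.SUN N)) := by
      rw [integral_berezin_fWSU_update hL hN e _ V, mul_assoc F (spinPair _ _) (bondFactorSU _ _ _), spinPair_mul_bondFactorSU,
        ← mul_assoc]
    rw [hback, ← integral_const_mul, ← RCLike.re_eq_complex_re, ← integral_re (hV.const_mul _)] at hkey
    have hp0 : 0 ≤ plaqSU N ν L β (Function.update V e 1) := (plaqSU_pos β _).le
    calc plaqSU N ν L β (Function.update V e 1) * _
        ≤ plaqSU N ν L β (Function.update V e 1) * ((N : ℝ) ^ 2 * ∫ g, RCLike.re (chiralSign (N := N) (evens ν L) *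
            berezin ℂ _ (F * spinPair (torusLinks ν L e).1 (torusLinks ν L e).2 * fWSU (Function.update V e g)))
            ∂(haarProbability (OneLink.SUN N))) := mul_le_mul_of_nonneg_left hkey hp0
      _ = _ := by
          rw [← integral_const_mul, ← integral_const_mul, ← integral_const_mul]
          refine integral_congr_ae (ae_of_all _ fun g => ?_)
          dsimp only
          rw [RCLike.re_eq_complex_re]
          ring
  -- Step 2: integrate, swap to the product, compare the plaquette weights
  have hI2 : Integrable (fun V : GaugeConfig ν L (OneLink.SUN N) => (N : ℝ) ^ 2 * ∫ g, plaqSU N ν L β (Function.update V e 1) *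
      (chiralSign (N := N) (evens ν L) * berezin ℂ _ (F * spinPair (torusLinks ν L e).1 (torusLinks ν L e).2 *
        fWSU (Function.update V e g))).re ∂(haarProbability (OneLink.SUN N))) (gaugeMeasureSU N (Edge ν L)) :=
    hR1.integral_prod_left.const_mul _
  have hcmp : ∫ p, plaqSU N ν L β (Function.update p.1 e 1) * (chiralSign (N := N) (evens ν L) *
        berezin ℂ _ (F * spinPair (torusLinks ν L e).1 (torusLinks ν L e).2 * fWSU (Function.update p.1 e p.2))).re
        ∂((gaugeMeasureSU N (Edge ν L)).prod (haarProbability (OneLink.SUN N))) ≤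
      Real.exp (β * linkOsc ν N) * suSB N ν L β (F * spinPair (torusLinks ν L e).1 (torusLinks ν L e).2) := by
    rw [suSB_eq_integral_prod hL β e, ← integral_const_mul]
    refine integral_mono hR1 (hRg.const_mul _) fun p => ?_
    dsimp only
    rw [← mul_assoc]
    exact mul_le_mul_of_nonneg_right (plaqSU_update_le hβ p.1 e 1 p.2) (chiralSign_mul_berezin_fWSU hL hFT _).1
  calc _ ≤ ∫ V, (N : ℝ) ^ 2 * ∫ g, plaqSU N ν L β (Function.update V e 1) * (chiralSign (N := N) (evens ν L) *
          berezin ℂ _ (F * spinPair (torusLinks ν L e).1 (torusLinks ν L e).2 * fWSU (Function.update V e g))).re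
          ∂(haarProbability (OneLink.SUN N)) ∂(gaugeMeasureSU N (Edge ν L)) := integral_mono_ae hL1 hI2 hstep1
    _ = (N : ℝ) ^ 2 * ∫ p, plaqSU N ν L β (Function.update p.1 e 1) * (chiralSign (N := N) (evens ν L) *
          berezin ℂ _ (F * spinPair (torusLinks ν L e).1 (torusLinks ν L e).2 * fWSU (Function.update p.1 e p.2))).re
          ∂((gaugeMeasureSU N (Edge ν L)).prod (haarProbability (OneLink.SUN N))) := by
        rw [integral_const_mul, integral_prod _ hR1]
    _ ≤ (N : ℝ) ^ 2 * (Real.exp (β * linkOsc ν N) * suSB N ν L β (F * spinPair (torusLinks ν L e).1 (torusLinks ν L e).2)) :=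
        mul_le_mul_of_nonneg_left hcmp (sq_nonneg _)
    _ = _ := by ring

end SchwingerDysonSU

end Summit.Ventures.YMGap.Conjectures

end
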